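import Literature.MathematicalPhysics.QuantumFieldTheory.Balaban1983to89.B9Eq386GreenAnalyticPencilEnergy
import Mathlib.Analysis.SpecialFunctions.Log.Basic

/-!
# `Balaban1983to89.B9Eq386GreenGroupPencilEnergy` — T. Bałaban, *Propagators for lattice gauge theories in a background field*, Commun. Math. Phys.
# **99** (1985) 389–434 [Balaban1985BackgroundPropagators] Thm 3.4 p. 400, (3.50)–(3.53) p. 400, (3.84)–(3.86) p. 407, with T. Kato, *Perturbation theory for
# linear operators* (1966) [Kato1966] Ch. VII §4: **THE GROUP PENCIL IS TYPE (B) TOO — the inverse of an ANALYTIC operator pencil `S₀ + D(z)` with `S₀`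
# `γ`-coercive in a weight `N ≥ ‖·‖` and `D` analytic of FORM size `Θ₁ < γ` on the closed disc `‖z‖ ≤ R₁` is analytic there, bounded by `(γ − Θ₁)⁻¹`,
# with the resolvent derivative `G′ = −G·D′·G`, CAUCHY majorants `n!(γ − Θ₁)⁻¹R₁⁻ⁿ` (any centre), LIPSCHITZ constant `(γ − Θ₁)⁻¹∕(R₁ − r)` on every
# smaller disc, and — for the group pencil's defect FUNCTION `C((e^{ρa})ⁿ − 1)` — the explicit radius `ρ⋆ = log(1 + θ∕C)∕(na)` at which the margin is
# `γ − θ`** — abstract finite-dimensional Hilbert letters; the NONLINEAR-pencil sibling of this lineage's `B9Eq386GreenAnalyticPencilEnergy` (N53, linear pencil)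

statement-level skeleton of published theorems with citation tags; proofs where landed; nothing here is a claim about the Yang–Mills mass gap

CITATION HEADER (lean-in-tree rule).  Audit cell `pub-balaban`, sub-cell `t4`, BINDER row NE9; filed by NE9 formalisation-swarm LEAF PROVER 01
(`b2b-balaban-t4-ne9-formalise-leaf-01`, gen 89) under the crux-ideation seat t4-ne9-idea-1 gen 153's located note N54 («THE GROUP PENCIL IS TYPE (B)
TOO»; cell journal 2026-08-25 l.64371 ∕ l.64788; card `t4/ideate/NE9/lens1-g153/N54-GROUP-PENCIL-g153.md`), leaf-01 named first.  CREDIT: the mechanism AND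
the Lean text of §§1–5 are t4-ne9-idea-1 g153's scratch kernel `NE9GroupPencilTypeB` (ccac8e3be9f51d84, §0 `hasDerivAt_inverse_comp`, §1, §4, §5, §6;
NOT-TO-FILE under the cell's FREEZE (0)), ported here token for token except: the kernel's §0 duplicates of N53 are NOT repeated (this lineage's
`B9Eq386GreenAnalyticPencilEnergy` enters BY NAME: `coerciveN_of_formDefect`, `rePos_of_coerciveN`, `isUnit_of_rePos`, `norm_inverse_le`,
`weight_inverse_apply_le`, `analyticAt_inverse_comp`), and the kernel's `def rhoStar` is written out as `Real.log (1 + θ ∕ C) ∕ (n * a)` (proof lane: no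
`def`).  Namespace, header and docstring locators are this seat's.  Sources READ first-hand in the held text layer (`paper:balaban1985-cmp99-background-propagators`,
journal page = PDF page + 388): p. 400 Thm 3.4 *«There exists a positive constant a₁ such that the operators G₁(U), (Q′(U)G′₂(U)Q′*(U))⁻¹, R(U), G(U)
extend to configurations U′U for α′₁ ≤ a₁ as analytic functions of A»*, `U′ = e^{iηA}`, `A` *«with values in the complexified Lie algebra g^c»*; (3.50)
the expansion of `exp(iη ad_{A′(b)})R(U_b)`; (3.51)–(3.52) `F′_{1,k}(z) = η⁻²(e^{ηz} − 1 − ηz)` *«hence F′_{1,k}(i ad_{A′(b)}) is an analytic function of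
A(b)»*; (3.53) `Δ_{U′U} = Δ_U − V₁(A)`; p. 407 (3.84) `Δ_a(U′U) = Δ_a(U) − V(A) = (I − V(A)G(U))Δ_a(U)`, (3.86) `G(U′U) = G(U)(I − V(A)G(U))⁻¹ =
Σₙ G(U)(V(A)G(U))ⁿ` *«convergence is in the operator norm for α₁ sufficiently small»*, *«assuming that Theorem 3.3 holds for G(U)»*.  Print's
analyticity is the operator-norm Neumann series fed by Thm 3.3's decay (in the tree: `B9Eq386NeumannAnalytic.analyticAt_gNew_comp`,
`B9Eq352Analytic`); the FORM-currency pencil here is the ROUTE's substitute (`t4/ROUTES-NE9.md` §L1.4, N52 ∕ N53 ∕ N54); nothing of print's radius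
`a₁` is asserted.

WHY THIS FILE (cell context, N54 §1, §4, §5).  N53 (`B9Eq386GreenAnalyticPencilEnergy`) typed the LINEAR pencil `S₀ + z•D` (two fixed backgrounds
joined by a segment).  Print's own continuation is the GROUP pencil `z ↦ U·e^{zA}`: `D(z) := H_κ(U·e^{zA}) − H_κ(U)` is NOT linear in `z`, but it is
analytic (every matrix coefficient is a finite sum of words in the entire letters `U(b)e^{zηA(b)}`, `e^{−zηA(b)}U(b)⁻¹` and their TRANSPOSES —
the sibling `B9Eq350GroupPencilLettersEntire` §1; print's `Q*`, `Q′*`, `R` continue as transposes, a Hilbert-adjoint-typed chain agrees with them at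
unitary `U` only) and its form defect against the REAL base point is a FUNCTION of `|z|` bounded by `C((e^{|z|a})ⁿ − 1)` (binomial telescoping, the
sibling `B9Eq350GroupPencilWordDefect` §1).  §2 below is N53's pencil with `z•D ↦ D(z)` (coercivity is open under a form defect, Lax–Milgram at each point, the inverse is
a unit, Mathlib's `analyticAt_inverse` composes; Cauchy on the disc gives every order and, through the derivative, the Lipschitz constant on smaller
discs); §3–§4 solve `C((e^{ρa})ⁿ − 1) = θ` for the radius and hand §2 its constant `Θ₁ := Θ(R₁)`.  Every constant is a function of
`(γ, θ, C, n, a)` — free of `η`, of the level and of the volume exactly as far as `C, n, a` are.  The LATTICE junction (the typed `D(z)` over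
`B9Eq326ConjugatedDeltaATwoBackgroundsPencil`'s binder list) is NOT here.

WHAT IS PROVED (sorry-free; proof lane — no `def`; [folklore] finite-dimensional Hilbert-space algebra + Mathlib complex analysis).
* §1 **`hasDerivAt_inverse_comp`**: `HasDerivAt f f′ z₀`, `f z₀` a unit ⟹ `HasDerivAt (z ↦ (f z)⁻¹) (−(f z₀)⁻¹·f′·(f z₀)⁻¹) z₀` (differentiability
  only; t4-ne9-idea-1 g154 L-g154-1).
* §2 the analytic pencil (`hco`, `hDΘ : |⟪u, D(z)v⟫| ≤ Θ₁N(u)N(v)` and `hDa : AnalyticAt ℂ D z` on `‖z‖ ≤ R₁`, `Θ₁ < γ`, `0 < R₁`): `formDefect_apencil`,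
  `coerciveN_apencil` (`(γ − Θ₁)N² ≤ re⟪u,(S₀ + D z)u⟫`), **`norm_inverse_apencil_le`** (`‖(S₀ + D z)⁻¹‖ ≤ (γ − Θ₁)⁻¹`), `isUnit_apencil`,
  `analyticAt_inverse_apencil`, **`hasDerivAt_inverse_apencil`** (`G′(z) = −G(z)·D′(z)·G(z)`), **`norm_iteratedDeriv_inverse_apencil_le`**
  (`‖G⁽ⁿ⁾(0)‖ ≤ n!·(γ − Θ₁)⁻¹∕R₁ⁿ`), `norm_iteratedDeriv_inverse_apencil_le_at` (centre `z₀`, `‖z₀‖ + r ≤ R₁`: `≤ n!·(γ − Θ₁)⁻¹∕rⁿ`),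
  **`norm_inverse_sub_inverse_apencil_le`** (`r < R₁`, `‖z‖, ‖w‖ ≤ r` ⟹ `‖G(z) − G(w)‖ ≤ (γ − Θ₁)⁻¹∕(R₁ − r)·‖z − w‖`),
  `weight_inverse_apencil_apply_le` (`N(G(z)y) ≤ (γ − Θ₁)⁻¹‖y‖`).
* §3 radius `ρ⋆ = log(1 + θ∕C)∕(n·a)` (written out): `logRadius_pos`, **`defect_at_logRadius`** (`C·((e^{ρ⋆a})ⁿ − 1) = θ`), `defect_le_of_le_logRadius`.
* §4 junction: `formBound_of_defectFunction` (a monotone defect function `Θ(ρ)` on `[0, R₁]` gives §2's `hDΘ` with `Θ₁ := Θ(R₁)`), `groupDefect_mono`,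
  **`gap_at_logRadius`** (`θ < γ` ⟹ at `R₁ = ρ⋆` the defect constant is `< γ` and `0 < ρ⋆`), and THE END BY NAME (§2 ∘ §3 ∘ §4 composed):
  **`norm_inverse_gpencil_le_of_defectFunction`** (defect function `C((e^{‖z‖a})ⁿ − 1)` on the disc of radius `ρ⋆`, `θ < γ` ⟹ `‖(S₀ + D z)⁻¹‖ ≤
  (γ − θ)⁻¹`), **`norm_iteratedDeriv_gpencil_le_of_defectFunction`** (`+ hDa` ⟹ `‖G⁽ᵐ⁾(0)‖ ≤ m!·(γ − θ)⁻¹∕ρ⋆ᵐ`),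
  **`norm_inverse_sub_inverse_gpencil_le_of_defectFunction`** (`+ hDa`, `r < ρ⋆` ⟹ `‖G(z) − G(w)‖ ≤ (γ − θ)⁻¹∕(ρ⋆ − r)·‖z − w‖`).
* §5 non-vacuity (`E = ℂ`, `S₀ = 1`, `D z = z•0`).
MODEL ∕ HONEST SCOPE.  (M1) abstract letters; `E` finite-dimensional over `ℂ` in §2.  (M2) DISPLAYED: `γ`, `Θ₁`, `R₁` (§2), `C, n, a, θ` (§§3–4); at
the lattice `γ = γ′ = min(¼, γ_{3.11}∕8)` of `B9Eq326ConjugatedDeltaAEnergyWeight.coerciveN_k`, `C, n` from `B9Eq326ConjugatedDeltaAFormDefect`'s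
defect polynomial, `a` = the (3.37) size of `A` (magnitude AND lattice derivative at the second-order letters) — that junction is NOT here.  (M3) by one
complex line at a time this is Gâteaux holomorphy + local boundedness in `A`; Hartogs (joint holomorphy on the `𝔤^ℂ`-ball) NOT typed.  (M4) not
print's Thm 3.4 ∕ (3.86) (operator currency, Neumann series fed by Thm 3.3) and no replacement for it where print needs operator ∕ kernel currency;
no kernel ∕ sup bound, no `δ₀`; no rate, no window evaluated; NOT `hold` of `T4CouplingAnalyticity` (holomorphy in the OLD DATA).  NOT NE9 (cell
pub-balaban: NE9 NOT PRINTED ∕ NOT PROVED; «NE9 ⇐ the named binders»; row WALLED ON A MODEL (O-NE9-1; #5 UNRULED); spine PROVED 0∕9; rung (B)+1 on a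
finite T⁴ — NOT infinite volume, NOT mass gap, NOT BetaPertH, NOT Clay).  HONEST DEPENDENCY (cell line): continuum YM on T⁴ ⇐ BetaPertH ∧ nine spine
estimates (0/9 proved); BetaPertH ⇐ (D1) ∧ (D4) ∧ CAP+tail; G-an2-4 gates asym, D1 and NE2/3/4.  NEW file; nothing modified.  Net new unproved facts: 0.
-/

noncomputable section

open scoped InnerProductSpace ComplexConjugate
open Metric Set

namespace Literature.MathematicalPhysics.QuantumFieldTheory.Balaban1983to89.B9Eq386GreenGroupPencilEnergy

open B9Eq386GreenAnalyticPencilEnergy (coerciveN_of_formDefect rePos_of_coerciveN isUnit_of_rePos norm_inverse_le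
  weight_inverse_apply_le analyticAt_inverse_comp)

/-! ## §1 The resolvent derivative of a differentiable unit-valued family -/

section Analytic

variable {E : Type*} [NormedAddCommGroup E] [InnerProductSpace ℂ E] [CompleteSpace E]

/-- **THE RESOLVENT DERIVATIVE** `(f⁻¹)′(z₀) = −f(z₀)⁻¹·f′·f(z₀)⁻¹` for a unit-valued family DIFFERENTIABLE at `z₀` (no analyticity needed at this
step) — (3.86) differentiated, with the inverse a UNIT of `E →L[ℂ] E` rather than a Neumann sum (Mathlib `hasFDerivAt_ringInverse` BY NAME, composed by
`HasFDerivAt.comp_hasDerivAt_of_eq`; hypothesis weakened from `AnalyticAt` to `HasDerivAt` on t4-ne9-idea-1 g154's located remark L-g154-1). [folklore]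
[cite: Balaban1985BackgroundPropagators, (3.86) p.407; Kato1966, Ch. VII §4] -/
theorem hasDerivAt_inverse_comp {f : ℂ → (E →L[ℂ] E)} {f' : E →L[ℂ] E} {z₀ : ℂ} (hf : HasDerivAt f f' z₀) (hu : IsUnit (f z₀)) :
    HasDerivAt (fun z => Ring.inverse (f z)) (-(Ring.inverse (f z₀) * f' * Ring.inverse (f z₀))) z₀ := by
  have h1 : HasFDerivAt Ring.inverse
      (-((ContinuousLinearMap.mulLeftRight ℂ (E →L[ℂ] E)) ↑hu.unit⁻¹ ↑hu.unit⁻¹)) (↑hu.unit : E →L[ℂ] E) :=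
    hasFDerivAt_ringInverse hu.unit
  have h3 := h1.comp_hasDerivAt_of_eq z₀ hf hu.unit_spec
  have h4 : (↑hu.unit⁻¹ : E →L[ℂ] E) = Ring.inverse (f z₀) := by
    rw [← Ring.inverse_unit hu.unit, hu.unit_spec]
  have h6 : (-((ContinuousLinearMap.mulLeftRight ℂ (E →L[ℂ] E)) ↑hu.unit⁻¹ ↑hu.unit⁻¹)) f'
      = -(Ring.inverse (f z₀) * f' * Ring.inverse (f z₀)) := by
    rw [h4]; simp
  refine HasDerivAt.congr_deriv ?_ h6
  exact h3

end Analytic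

/-! ## §2 THE ANALYTIC PENCIL `S₀ + D(z)` on the closed disc `‖z‖ ≤ R₁` -/

section APencil

variable {E : Type*} [NormedAddCommGroup E] [InnerProductSpace ℂ E] [CompleteSpace E] [FiniteDimensional ℂ E]
  (N : E → ℝ) (hN : ∀ w, 0 ≤ N w) (hNn : ∀ u, ‖u‖ ≤ N u) {γ Θ₁ R₁ : ℝ} (hR₁ : 0 < R₁) (hgap : Θ₁ < γ)
  (S₀ : E →L[ℂ] E) (D : ℂ → (E →L[ℂ] E)) (hco : ∀ u, γ * N u ^ 2 ≤ RCLike.re ⟪u, S₀ u⟫_ℂ)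
  (hDΘ : ∀ z : ℂ, ‖z‖ ≤ R₁ → ∀ u v, ‖⟪u, D z v⟫_ℂ‖ ≤ Θ₁ * N u * N v)
  (hDa : ∀ z : ℂ, ‖z‖ ≤ R₁ → AnalyticAt ℂ D z)

omit [CompleteSpace E] [FiniteDimensional ℂ E] in
include hDΘ in
/-- The form defect of `S₀ + D z` against `S₀` on the disc is `Θ₁`. [folklore] [cite: Kato1966, Ch. VII §4; Balaban1985BackgroundPropagators, (3.53) p.400] -/
theorem formDefect_apencil {z : ℂ} (hz : ‖z‖ ≤ R₁) (u v : E) :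
    ‖⟪u, (S₀ + D z) v⟫_ℂ - ⟪u, S₀ v⟫_ℂ‖ ≤ Θ₁ * N u * N v := by
  have h0 : (S₀ + D z) v = S₀ v + D z v := rfl
  rw [h0, inner_add_right, add_sub_cancel_left]
  exact hDΘ z hz u v

omit [CompleteSpace E] [FiniteDimensional ℂ E] in
include hco hDΘ in
/-- **ON THE CLOSED DISC THE ANALYTIC PENCIL IS `(γ − Θ₁)`-COERCIVE IN `N`** — from FORM size `Θ₁ < γ` only (type (B) openness, quantitative).
[folklore] [cite: Kato1966, Ch. VII §4; Balaban1985BackgroundPropagators, Thm 3.4 p.400] -/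
theorem coerciveN_apencil {z : ℂ} (hz : ‖z‖ ≤ R₁) (u : E) : (γ - Θ₁) * N u ^ 2 ≤ RCLike.re ⟪u, (S₀ + D z) u⟫_ℂ :=
  coerciveN_of_formDefect N (T₀ := fun v => S₀ v) (T := fun v => (S₀ + D z) v) hco (formDefect_apencil N S₀ D hDΘ hz) u

omit [CompleteSpace E] in
include hN hNn hgap hco hDΘ in
/-- **UNIFORM INVERSE BOUND ON THE DISC**: `‖(S₀ + D z)⁻¹‖ ≤ (γ − Θ₁)⁻¹` for `‖z‖ ≤ R₁`. [folklore]
[cite: Kato1966, Ch. VII §4; Balaban1985BackgroundPropagators, Thm 3.4 p.400] -/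
theorem norm_inverse_apencil_le {z : ℂ} (hz : ‖z‖ ≤ R₁) : ‖Ring.inverse (S₀ + D z)‖ ≤ (γ - Θ₁)⁻¹ :=
  norm_inverse_le N hN hNn (sub_pos.mpr hgap) (S₀ + D z) (coerciveN_apencil N S₀ D hco hDΘ hz)

omit [CompleteSpace E] in
include hNn hgap hco hDΘ in
/-- Every member of the pencil on the disc is a unit of `E →L[ℂ] E` (Lax–Milgram at each point of the disc; finite dimension). [folklore]
[cite: Balaban1985BackgroundPropagators, Thm 3.4 p.400, Thm 3.11 p.416] -/
theorem isUnit_apencil {z : ℂ} (hz : ‖z‖ ≤ R₁) : IsUnit (S₀ + D z) :=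
  isUnit_of_rePos (S₀ + D z) (rePos_of_coerciveN N hNn (sub_pos.mpr hgap) (coerciveN_apencil N S₀ D hco hDΘ hz))

include hNn hgap hco hDΘ hDa in
/-- **ANALYTICITY**: `z ↦ (S₀ + D z)⁻¹` is analytic at every point of the closed disc (Mathlib's `analyticAt_inverse` around ANY unit — no Neumann
smallness in operator norm). [folklore] [cite: Balaban1985BackgroundPropagators, Thm 3.4 p.400, (3.86) p.407; Kato1966, Ch. VII §4] -/
theorem analyticAt_inverse_apencil {z : ℂ} (hz : ‖z‖ ≤ R₁) : AnalyticAt ℂ (fun w : ℂ => Ring.inverse (S₀ + D w)) z := by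
  have hf : AnalyticAt ℂ (fun w : ℂ => S₀ + D w) z := analyticAt_const.add (hDa z hz)
  exact analyticAt_inverse_comp hf (isUnit_apencil N hNn hgap S₀ D hco hDΘ hz)

include hNn hgap hco hDΘ hDa in
/-- **THE RESOLVENT DERIVATIVE ON THE DISC**: `G′(z) = −G(z)·D′(z)·G(z)` — the first-order perturbation formula along the pencil. [folklore]
[cite: Balaban1985BackgroundPropagators, (3.86) p.407; Kato1966, Ch. VII §4] -/
theorem hasDerivAt_inverse_apencil {z : ℂ} (hz : ‖z‖ ≤ R₁) :
    HasDerivAt (fun w : ℂ => Ring.inverse (S₀ + D w))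
      (-(Ring.inverse (S₀ + D z) * deriv D z * Ring.inverse (S₀ + D z))) z := by
  have hf : HasDerivAt (fun w : ℂ => S₀ + D w) (deriv D z) z :=
    ((hDa z hz).differentiableAt.hasDerivAt).const_add S₀
  exact hasDerivAt_inverse_comp hf (isUnit_apencil N hNn hgap S₀ D hco hDΘ hz)

include hN hNn hgap hco hDΘ hDa hR₁ in
/-- **CAUCHY AT EVERY ORDER**: `‖iteratedDeriv n (z ↦ (S₀ + D z)⁻¹) 0‖ ≤ n!·(γ − Θ₁)⁻¹∕R₁ⁿ` — the perturbation coefficients in the pencil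
parameter are majorised GEOMETRICALLY with ratio `R₁⁻¹`, from form smallness on the disc only. [folklore]
[cite: Kato1966, Ch. VII §4 (analytic families of type (B)); Balaban1985BackgroundPropagators, (3.86) p.407] -/
theorem norm_iteratedDeriv_inverse_apencil_le (n : ℕ) :
    ‖iteratedDeriv n (fun w : ℂ => Ring.inverse (S₀ + D w)) 0‖ ≤ n.factorial * (γ - Θ₁)⁻¹ / R₁ ^ n := by
  have hdiff : DifferentiableOn ℂ (fun w : ℂ => Ring.inverse (S₀ + D w)) (closedBall 0 R₁) := fun z hz =>
    (analyticAt_inverse_apencil N hNn hgap S₀ D hco hDΘ hDa (by simpa using hz)).differentiableAt.differentiableWithinAt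
  have hdc : DiffContOnCl ℂ (fun w : ℂ => Ring.inverse (S₀ + D w)) (ball 0 R₁) := hdiff.diffContOnCl_ball (le_refl _)
  exact Complex.norm_iteratedDeriv_le_of_forall_mem_sphere_norm_le n hR₁ hdc fun z hz =>
    norm_inverse_apencil_le N hN hNn hgap S₀ D hco hDΘ (by rw [mem_sphere_zero_iff_norm.mp hz])

include hN hNn hgap hco hDΘ hDa in
/-- **CAUCHY AT EVERY ORDER, ANY CENTRE**: for `0 < r` and `‖z₀‖ + r ≤ R₁`: `‖iteratedDeriv n G z₀‖ ≤ n!·(γ − Θ₁)⁻¹∕rⁿ`. [folklore]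
[cite: Kato1966, Ch. VII §4; Balaban1985BackgroundPropagators, (3.86) p.407] -/
theorem norm_iteratedDeriv_inverse_apencil_le_at {z₀ : ℂ} {r : ℝ} (hr : 0 < r) (hzr : ‖z₀‖ + r ≤ R₁) (n : ℕ) :
    ‖iteratedDeriv n (fun w : ℂ => Ring.inverse (S₀ + D w)) z₀‖ ≤ n.factorial * (γ - Θ₁)⁻¹ / r ^ n := by
  have hsub : closedBall z₀ r ⊆ closedBall (0 : ℂ) R₁ := by
    intro y hy
    have hy' : ‖y - z₀‖ ≤ r := by simpa [dist_eq_norm] using hy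
    have : ‖y‖ ≤ ‖y - z₀‖ + ‖z₀‖ := by
      calc ‖y‖ = ‖(y - z₀) + z₀‖ := by rw [sub_add_cancel]
        _ ≤ ‖y - z₀‖ + ‖z₀‖ := norm_add_le _ _
    simpa using (this.trans (by linarith))
  have hdiff : DifferentiableOn ℂ (fun w : ℂ => Ring.inverse (S₀ + D w)) (closedBall 0 R₁) := fun z hz =>
    (analyticAt_inverse_apencil N hNn hgap S₀ D hco hDΘ hDa (by simpa using hz)).differentiableAt.differentiableWithinAt
  have hdc : DiffContOnCl ℂ (fun w : ℂ => Ring.inverse (S₀ + D w)) (ball z₀ r) := hdiff.diffContOnCl_ball hsub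
  exact Complex.norm_iteratedDeriv_le_of_forall_mem_sphere_norm_le n hr hdc fun z hz =>
    norm_inverse_apencil_le N hN hNn hgap S₀ D hco hDΘ (by simpa using hsub (sphere_subset_closedBall hz))

include hN hNn hgap hco hDΘ hDa in
/-- **LIPSCHITZ IN THE PENCIL PARAMETER ON EVERY SMALLER DISC**: for `r < R₁` and `‖z‖, ‖w‖ ≤ r`,
`‖(S₀ + D z)⁻¹ − (S₀ + D w)⁻¹‖ ≤ (γ − Θ₁)⁻¹∕(R₁ − r)·‖z − w‖` (Cauchy for the derivative on the discs `closedBall x (R₁ − r) ⊆ closedBall 0 R₁`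
and the mean value inequality on the convex disc) — two backgrounds on one pencil differ by a LIPSCHITZ amount in the pencil parameter. [folklore]
[cite: Kato1966, Ch. VII §4; Balaban1985BackgroundPropagators, Thm 3.4 p.400 («small perturbations of the operators depending on U only»), (3.86) p.407] -/
theorem norm_inverse_sub_inverse_apencil_le {r : ℝ} (hr : r < R₁) {z w : ℂ} (hz : ‖z‖ ≤ r) (hw : ‖w‖ ≤ r) :
    ‖Ring.inverse (S₀ + D z) - Ring.inverse (S₀ + D w)‖ ≤ (γ - Θ₁)⁻¹ / (R₁ - r) * ‖z - w‖ := by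
  set g : ℂ → (E →L[ℂ] E) := fun w => Ring.inverse (S₀ + D w) with hg
  have hdiffAt : ∀ x : ℂ, ‖x‖ ≤ R₁ → DifferentiableAt ℂ g x := fun x hx =>
    (analyticAt_inverse_apencil N hNn hgap S₀ D hco hDΘ hDa hx).differentiableAt
  have hderiv : ∀ x ∈ closedBall (0 : ℂ) r, ‖deriv g x‖ ≤ (γ - Θ₁)⁻¹ / (R₁ - r) := by
    intro x hx
    have hx1 : ‖x‖ ≤ r := by simpa using hx
    have hsub : closedBall x (R₁ - r) ⊆ closedBall (0 : ℂ) R₁ := by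
      intro y hy
      have hy' : ‖y - x‖ ≤ R₁ - r := by simpa [dist_eq_norm] using hy
      have : ‖y‖ ≤ ‖y - x‖ + ‖x‖ := by
        calc ‖y‖ = ‖(y - x) + x‖ := by rw [sub_add_cancel]
          _ ≤ ‖y - x‖ + ‖x‖ := norm_add_le _ _
      simpa using (this.trans (by linarith))
    have hdiff : DifferentiableOn ℂ g (closedBall (0 : ℂ) R₁) := fun y hy =>
      (hdiffAt y (by simpa using hy)).differentiableWithinAt
    have hdc : DiffContOnCl ℂ g (ball x (R₁ - r)) := hdiff.diffContOnCl_ball hsub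
    refine Complex.norm_deriv_le_of_forall_mem_sphere_norm_le (sub_pos.mpr hr) hdc fun y hy => ?_
    have hy' : ‖y‖ ≤ R₁ := by simpa using hsub (sphere_subset_closedBall hy)
    exact norm_inverse_apencil_le N hN hNn hgap S₀ D hco hDΘ hy'
  have hwm : w ∈ closedBall (0 : ℂ) r := by simpa using hw
  have hzm : z ∈ closedBall (0 : ℂ) r := by simpa using hz
  have hmv := (convex_closedBall (0 : ℂ) r).norm_image_sub_le_of_norm_deriv_le
    (fun x hx => hdiffAt x ((show ‖x‖ ≤ r by simpa using hx).trans hr.le)) hderiv hwm hzm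
  simpa [hg] using hmv

omit [CompleteSpace E] in
include hN hNn hgap hco hDΘ in
/-- **THE ROWS RIDE ALONG**: `N((S₀ + D z)⁻¹y) ≤ (γ − Θ₁)⁻¹‖y‖` for every member of the family (the input of the decay read-out when a
conjugation `κ` is frozen inside `S₀, D`). [folklore] [cite: Balaban1985BackgroundPropagators, Thm 3.4 p.400, (3.49) p.399] -/
theorem weight_inverse_apencil_apply_le {z : ℂ} (hz : ‖z‖ ≤ R₁) (y : E) :
    N (Ring.inverse (S₀ + D z) y) ≤ (γ - Θ₁)⁻¹ * ‖y‖ :=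
  weight_inverse_apply_le N hN hNn (sub_pos.mpr hgap) (S₀ + D z) (coerciveN_apencil N S₀ D hco hDΘ hz) y

end APencil

/-! ## §3 RADIUS BOOKKEEPING: `ρ⋆ = log(1 + θ∕C)∕(n·a)` (written out; no `def`) -/

section Radius

/-- The admissible radius `log(1 + θ∕C)∕(n·a)` of the group pencil is positive (`C, a, θ > 0`, `n ≥ 1`). [folklore]
[cite: Balaban1985BackgroundPropagators, Thm 3.4 p.400 (the constant `a₁`)] -/
theorem logRadius_pos {C a θ : ℝ} {n : ℕ} (hC : 0 < C) (ha : 0 < a) (hθ : 0 < θ) (hn : 0 < n) :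
    0 < Real.log (1 + θ / C) / (n * a) := by
  have h1 : 1 < 1 + θ / C := by have := div_pos hθ hC; linarith
  have h2 : (0 : ℝ) < n := Nat.cast_pos.mpr hn
  exact div_pos (Real.log_pos h1) (mul_pos h2 ha)

/-- **AT THE RADIUS THE WORD-DEFECT BUDGET IS EXACTLY `θ`**: `C·((e^{ρ⋆·a})ⁿ − 1) = θ` for `ρ⋆ = log(1 + θ∕C)∕(n·a)`. [folklore]
[cite: Balaban1985BackgroundPropagators, Thm 3.4 p.400, (3.50)–(3.53) p.400] -/
theorem defect_at_logRadius {C a θ : ℝ} {n : ℕ} (hC : 0 < C) (ha : 0 < a) (hθ : 0 < θ) (hn : 0 < n) :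
    C * (Real.exp (Real.log (1 + θ / C) / (n * a) * a) ^ n - 1) = θ := by
  have hn' : (n : ℝ) ≠ 0 := Nat.cast_ne_zero.mpr (Nat.pos_iff_ne_zero.mp hn)
  have h3 : (n : ℝ) * (Real.log (1 + θ / C) / (n * a) * a) = Real.log (1 + θ / C) := by
    field_simp
  have h4 : 0 < 1 + θ / C := by have := div_pos hθ hC; linarith
  rw [← Real.exp_nat_mul, h3, Real.exp_log h4, add_sub_cancel_left, mul_div_cancel₀ θ hC.ne']

/-- **MONOTONE ADMISSIBILITY**: for `ρ ≤ ρ⋆ = log(1 + θ∕C)∕(n·a)`, `C·((e^{ρa})ⁿ − 1) ≤ θ`. [folklore]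
[cite: Balaban1985BackgroundPropagators, Thm 3.4 p.400] -/
theorem defect_le_of_le_logRadius {C a θ ρ : ℝ} {n : ℕ} (hC : 0 < C) (ha : 0 < a) (hθ : 0 < θ) (hn : 0 < n)
    (hρ : ρ ≤ Real.log (1 + θ / C) / (n * a)) : C * (Real.exp (ρ * a) ^ n - 1) ≤ θ := by
  rw [← defect_at_logRadius hC ha hθ hn]
  have h1 : Real.exp (ρ * a) ≤ Real.exp (Real.log (1 + θ / C) / (n * a) * a) :=
    Real.exp_le_exp.mpr (mul_le_mul_of_nonneg_right hρ ha.le)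
  have h2 : Real.exp (ρ * a) ^ n ≤ Real.exp (Real.log (1 + θ / C) / (n * a) * a) ^ n :=
    pow_le_pow_left₀ (Real.exp_pos _).le h1 n
  exact mul_le_mul_of_nonneg_left (sub_le_sub_right h2 1) hC.le

end Radius

/-! ## §4 JUNCTION: a monotone defect FUNCTION on `[0, R₁]` feeds §2 with `Θ₁ := Θ(R₁)` -/

section Junction

variable {E : Type*} [NormedAddCommGroup E] [InnerProductSpace ℂ E]

/-- If the form defect of `D z` is bounded by `Θ(‖z‖)·N(u)N(v)` with `Θ` monotone on `[0, R₁]`, then on the closed disc it is bounded by the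
constant `Θ(R₁)` — the hypothesis `hDΘ` of §2. [folklore] [cite: Kato1966, Ch. VII §4; Balaban1985BackgroundPropagators, (3.53) p.400] -/
theorem formBound_of_defectFunction (N : E → ℝ) (hN : ∀ w, 0 ≤ N w) {R₁ : ℝ} (Θ : ℝ → ℝ)
    (hmono : ∀ s t, 0 ≤ s → s ≤ t → t ≤ R₁ → Θ s ≤ Θ t) (D : ℂ → (E →L[ℂ] E))
    (hD : ∀ z : ℂ, ‖z‖ ≤ R₁ → ∀ u v, ‖⟪u, D z v⟫_ℂ‖ ≤ Θ ‖z‖ * N u * N v) :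
    ∀ z : ℂ, ‖z‖ ≤ R₁ → ∀ u v, ‖⟪u, D z v⟫_ℂ‖ ≤ Θ R₁ * N u * N v := by
  intro z hz u v
  have h1 := hD z hz u v
  have h2 : Θ ‖z‖ ≤ Θ R₁ := hmono ‖z‖ R₁ (norm_nonneg z) hz le_rfl
  have h3 : 0 ≤ N u * N v := mul_nonneg (hN u) (hN v)
  calc ‖⟪u, D z v⟫_ℂ‖ ≤ Θ ‖z‖ * N u * N v := h1
    _ = Θ ‖z‖ * (N u * N v) := by ring
    _ ≤ Θ R₁ * (N u * N v) := mul_le_mul_of_nonneg_right h2 h3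
    _ = Θ R₁ * N u * N v := by ring

/-- The group pencil's defect function `ρ ↦ C·((e^{ρa})ⁿ − 1)` is monotone on `[0, ∞)` (`C ≥ 0`, `a ≥ 0`). [folklore]
[cite: Balaban1985BackgroundPropagators, (3.50)–(3.53) p.400] -/
theorem groupDefect_mono {C a : ℝ} (hC : 0 ≤ C) (ha : 0 ≤ a) (n : ℕ) :
    ∀ s t : ℝ, 0 ≤ s → s ≤ t → C * (Real.exp (s * a) ^ n - 1) ≤ C * (Real.exp (t * a) ^ n - 1) := by
  intro s t _ hst
  have h1 : Real.exp (s * a) ≤ Real.exp (t * a) := Real.exp_le_exp.mpr (mul_le_mul_of_nonneg_right hst ha)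
  have h2 : Real.exp (s * a) ^ n ≤ Real.exp (t * a) ^ n := pow_le_pow_left₀ (Real.exp_pos _).le h1 n
  exact mul_le_mul_of_nonneg_left (sub_le_sub_right h2 1) hC

/-- **THE GAP AT THE RADIUS**: with `R₁ := ρ⋆ = log(1 + θ∕C)∕(n·a)` and `θ < γ`, the defect constant `Θ₁ = C·((e^{R₁a})ⁿ − 1) = θ` leaves the
coercivity margin `γ − θ > 0` of §2, and `0 < R₁` — every constant of §2 is then explicit in `(γ, θ, C, n, a)`. [folklore]
[cite: Balaban1985BackgroundPropagators, Thm 3.4 p.400 (the constant `a₁`); Kato1966, Ch. VII §4] -/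
theorem gap_at_logRadius {C a θ γ : ℝ} {n : ℕ} (hC : 0 < C) (ha : 0 < a) (hθ : 0 < θ) (hn : 0 < n) (hθγ : θ < γ) :
    C * (Real.exp (Real.log (1 + θ / C) / (n * a) * a) ^ n - 1) < γ ∧ 0 < Real.log (1 + θ / C) / (n * a) :=
  ⟨by rw [defect_at_logRadius hC ha hθ hn]; exact hθγ, logRadius_pos hC ha hθ hn⟩

/-- **THE GROUP-PENCIL END, BY NAME (N54 §3 «OUTPUT»)**: if `S₀` is `γ`-coercive in `N ≥ ‖·‖` and the form defect of `D(z)` is bounded by the group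
pencil's defect FUNCTION `C((e^{‖z‖a})ⁿ − 1)·N(u)N(v)` on the disc of radius `ρ⋆ = log(1 + θ∕C)∕(n·a)`, `θ < γ`, then every member there satisfies
`‖(S₀ + D z)⁻¹‖ ≤ (γ − θ)⁻¹` — §2 ∘ §3 ∘ §4 composed; every constant explicit in `(γ, θ, C, n, a)`. [folklore]
[cite: Balaban1985BackgroundPropagators, Thm 3.4 p.400, (3.50)–(3.53) p.400, (3.86) p.407; Kato1966, Ch. VII §4] -/
theorem norm_inverse_gpencil_le_of_defectFunction [CompleteSpace E] [FiniteDimensional ℂ E]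
    (N : E → ℝ) (hN : ∀ w, 0 ≤ N w) (hNn : ∀ u, ‖u‖ ≤ N u) {γ C a θ : ℝ} {n : ℕ}
    (hC : 0 < C) (ha : 0 < a) (hθ : 0 < θ) (hn : 0 < n) (hθγ : θ < γ)
    (S₀ : E →L[ℂ] E) (D : ℂ → (E →L[ℂ] E)) (hco : ∀ u, γ * N u ^ 2 ≤ RCLike.re ⟪u, S₀ u⟫_ℂ)
    (hD : ∀ z : ℂ, ‖z‖ ≤ Real.log (1 + θ / C) / (n * a) → ∀ u v, ‖⟪u, D z v⟫_ℂ‖ ≤ C * (Real.exp (‖z‖ * a) ^ n - 1) * N u * N v)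
    {z : ℂ} (hz : ‖z‖ ≤ Real.log (1 + θ / C) / (n * a)) :
    ‖Ring.inverse (S₀ + D z)‖ ≤ (γ - θ)⁻¹ := by
  have hΘ := formBound_of_defectFunction N hN (fun ρ => C * (Real.exp (ρ * a) ^ n - 1))
    (fun s t hs hst _ => groupDefect_mono hC.le ha.le n s t hs hst) D hD
  have hgap := (gap_at_logRadius hC ha hθ hn hθγ).1
  have h := norm_inverse_apencil_le N hN hNn hgap S₀ D hco hΘ hz
  rwa [defect_at_logRadius hC ha hθ hn] at h

/-- **… THE CAUCHY MAJORANTS AT THE RADIUS, BY NAME**: under the same data plus analyticity of `D` on the disc of radius `ρ⋆ = log(1 + θ∕C)∕(n·a)`,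
`‖iteratedDeriv m (z ↦ (S₀ + D z)⁻¹) 0‖ ≤ m!·(γ − θ)⁻¹∕ρ⋆ᵐ` — all orders with ONE constant `(γ − θ)⁻¹` and ONE radius `ρ⋆`, explicit in
`(γ, θ, C, n, a)`. [folklore] [cite: Balaban1985BackgroundPropagators, Thm 3.4 p.400, (3.86) p.407; Kato1966, Ch. VII §4] -/
theorem norm_iteratedDeriv_gpencil_le_of_defectFunction [CompleteSpace E] [FiniteDimensional ℂ E]
    (N : E → ℝ) (hN : ∀ w, 0 ≤ N w) (hNn : ∀ u, ‖u‖ ≤ N u) {γ C a θ : ℝ} {n : ℕ}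
    (hC : 0 < C) (ha : 0 < a) (hθ : 0 < θ) (hn : 0 < n) (hθγ : θ < γ)
    (S₀ : E →L[ℂ] E) (D : ℂ → (E →L[ℂ] E)) (hco : ∀ u, γ * N u ^ 2 ≤ RCLike.re ⟪u, S₀ u⟫_ℂ)
    (hD : ∀ z : ℂ, ‖z‖ ≤ Real.log (1 + θ / C) / (n * a) → ∀ u v, ‖⟪u, D z v⟫_ℂ‖ ≤ C * (Real.exp (‖z‖ * a) ^ n - 1) * N u * N v)
    (hDa : ∀ z : ℂ, ‖z‖ ≤ Real.log (1 + θ / C) / (n * a) → AnalyticAt ℂ D z) (m : ℕ) :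
    ‖iteratedDeriv m (fun w : ℂ => Ring.inverse (S₀ + D w)) 0‖ ≤
      m.factorial * (γ - θ)⁻¹ / (Real.log (1 + θ / C) / (n * a)) ^ m := by
  have hΘ := formBound_of_defectFunction N hN (fun ρ => C * (Real.exp (ρ * a) ^ n - 1))
    (fun s t hs hst _ => groupDefect_mono hC.le ha.le n s t hs hst) D hD
  have hgap := gap_at_logRadius hC ha hθ hn hθγ
  have h := norm_iteratedDeriv_inverse_apencil_le N hN hNn hgap.2 hgap.1 S₀ D hco hΘ hDa m
  rwa [defect_at_logRadius hC ha hθ hn] at h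

/-- **… AND THE LIPSCHITZ BOUND BETWEEN TWO MEMBERS, BY NAME**: under the same data plus analyticity of `D` on the disc, for `r < ρ⋆` and
`‖z‖, ‖w‖ ≤ r`: `‖(S₀ + D z)⁻¹ − (S₀ + D w)⁻¹‖ ≤ (γ − θ)⁻¹∕(ρ⋆ − r)·‖z − w‖` — road (α)'s two-background difference recovered as the group pencil's
Lipschitz constant, explicit in `(γ, θ, C, n, a, r)`. [folklore]
[cite: Balaban1985BackgroundPropagators, Thm 3.4 p.400 («small perturbations of the operators depending on U only»), (3.86) p.407; Kato1966, Ch. VII §4] -/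
theorem norm_inverse_sub_inverse_gpencil_le_of_defectFunction [CompleteSpace E] [FiniteDimensional ℂ E]
    (N : E → ℝ) (hN : ∀ w, 0 ≤ N w) (hNn : ∀ u, ‖u‖ ≤ N u) {γ C a θ : ℝ} {n : ℕ}
    (hC : 0 < C) (ha : 0 < a) (hθ : 0 < θ) (hn : 0 < n) (hθγ : θ < γ)
    (S₀ : E →L[ℂ] E) (D : ℂ → (E →L[ℂ] E)) (hco : ∀ u, γ * N u ^ 2 ≤ RCLike.re ⟪u, S₀ u⟫_ℂ)
    (hD : ∀ z : ℂ, ‖z‖ ≤ Real.log (1 + θ / C) / (n * a) → ∀ u v, ‖⟪u, D z v⟫_ℂ‖ ≤ C * (Real.exp (‖z‖ * a) ^ n - 1) * N u * N v)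
    (hDa : ∀ z : ℂ, ‖z‖ ≤ Real.log (1 + θ / C) / (n * a) → AnalyticAt ℂ D z)
    {r : ℝ} (hr : r < Real.log (1 + θ / C) / (n * a)) {z w : ℂ} (hz : ‖z‖ ≤ r) (hw : ‖w‖ ≤ r) :
    ‖Ring.inverse (S₀ + D z) - Ring.inverse (S₀ + D w)‖ ≤ (γ - θ)⁻¹ / (Real.log (1 + θ / C) / (n * a) - r) * ‖z - w‖ := by
  have hΘ := formBound_of_defectFunction N hN (fun ρ => C * (Real.exp (ρ * a) ^ n - 1))
    (fun s t hs hst _ => groupDefect_mono hC.le ha.le n s t hs hst) D hD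
  have hgap := (gap_at_logRadius hC ha hθ hn hθγ).1
  have h := norm_inverse_sub_inverse_apencil_le N hN hNn hgap S₀ D hco hΘ hDa hr hz hw
  rwa [defect_at_logRadius hC ha hθ hn] at h

end Junction

/-! ## §5 Non-vacuity: the constant pencil on `ℂ` -/

section NonVacuity

/-- The hypotheses of §2 are inhabited: `E = ℂ`, `N = ‖·‖`, `S₀ = 1` (`γ = 1`). [folklore] [cite: Kato1966, Ch. VII §4] -/
example : ∀ u : ℂ, (1 : ℝ) * ‖u‖ ^ 2 ≤ RCLike.re ⟪u, (1 : ℂ →L[ℂ] ℂ) u⟫_ℂ := fun u => by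
  simp [inner_self_eq_norm_sq_to_K]
  norm_cast

/-- … with `D z = z • 0` of form size `Θ₁ = 0` on any disc. [folklore] [cite: Kato1966, Ch. VII §4] -/
example : ∀ z : ℂ, ‖z‖ ≤ (1 : ℝ) → ∀ u v : ℂ, ‖⟪u, ((fun w : ℂ => w • (0 : ℂ →L[ℂ] ℂ)) z) v⟫_ℂ‖ ≤ (0 : ℝ) * ‖u‖ * ‖v‖ :=
  fun _ _ u v => by simp

/-- … and `D` analytic on the disc. [folklore] [cite: Kato1966, Ch. VII §4] -/
example : ∀ z : ℂ, ‖z‖ ≤ (1 : ℝ) → AnalyticAt ℂ (fun w : ℂ => w • (0 : ℂ →L[ℂ] ℂ)) z :=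
  fun _ _ => analyticAt_id.smul analyticAt_const

end NonVacuity

end Literature.MathematicalPhysics.QuantumFieldTheory.Balaban1983to89.B9Eq386GreenGroupPencilEnergy

end
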